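import Summits.QuantumFields.YangMills.Theorems.BalabanStepParabolic.Negative.EvenRedundant
import Literature.MathematicalPhysics.QuantumFieldTheory.BalabanRegulatorChart
import HarnessLib

/-!
# Crux `BalabanStepParabolic` — even block factors are dead weight for the regulator chart too

Support file for crux `stmt-QuantumFields-9684`
(`Summit.QuantumFields.YangMills.Theses.ParabolicTrajectory.BalabanStepParabolic`), line
`perfect-action-regulator-chart` (lead `prover-line-stmt-QuantumFields-9684-0`).

`nonempty_regulatorChart_of_even`: for every compact `G`, every lattice representation `r` and every EVEN `M ≥ 2`,
the line's posited object `RegulatorChart G r M` (Literature `BalabanRegulatorChart.lean`) is inhabited with zero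
renormalisation-group content — the disprover's thin even-`M` chart (`Negative/EvenRedundant.lean`: `E = ℝ`,
`φ g y = g + (log M) g³`, `Ψ g y = y/2`, `yW ≡ 1`, `betaOf = 1/g²`) carries the exact smooth half-chart normal
form (derivatives `∂_g φ = 1 + 3 log M g²`, `∂_y φ = 0`, `∂_g Ψ = 0`, `D_yΨ = ½·id = A`, constant `C = 1`), and its
functional `expectE` restricted to curvature strings is a `ChartRealisationData` (covariance from `expectE_step`,
arc identification from `expectE_wilson` + `wilsonCentredSchwinger_cInd`, continuity from `continuous_expectE`,
i.e. from finite-torus regularity, `Negative/TorusRegularity.lean`). Hence the line's load-bearing stub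
`∀ G r, ∃ M₀, ∀ M ≥ M₀, Nonempty (RegulatorChart G r M)` is equivalent to its restriction to ODD `M`
(`regulatorChartExists_iff_odd`), exactly as the crux is (`Negative.balabanStepParabolic_iff_odd`): the reshaped
skeleton (v5) keeps only `stub_regulatorChartOdd`.
-/

open scoped SchwartzMap
open MeasureTheory Filter Topology
open Literature.MathematicalPhysics.AQFT Literature.MathematicalPhysics.QuantumLattice
open Literature.Probability.LatticeModels
open Literature.MathematicalPhysics.QuantumFieldTheory
open Summit.QuantumFields.YangMills.Theorems.BalabanStepParabolic.Negative

noncomputable section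

namespace Summit.QuantumFields.YangMills.Theorems.BalabanStepParabolic

variable {G : Type} [Group G] [TopologicalSpace G] [IsTopologicalGroup G] [CompactSpace G]
  [MeasurableSpace G] [BorelSpace G] (r : LatticeRep G) (M : ℕ)

/-- The thin even-`M` chart carries the exact smooth half-chart normal form (`C = 1`, `b = 1 · log M`):
`φ g y = g + (log M) g³` has `∂_g φ = 1 + 3 log M g²`, `∂_y φ = 0`; `Ψ g y = y/2` has `∂_g Ψ = 0`,
`D_y Ψ = ½ · id`. [folklore] -/
theorem smoothHalfChart_thin :
    SmoothHalfChart ℝ (fun g _ => φJ M g) (fun _ y => (1 / 2 : ℝ) • y)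
      ((1 / 2 : ℝ) • ContinuousLinearMap.id ℝ ℝ)
      (fun g _ => 1 + 3 * Real.log M * g ^ 2) (fun _ _ => 0) (fun _ _ => 0)
      (fun _ _ => (1 / 2 : ℝ) • ContinuousLinearMap.id ℝ ℝ)
      (1 * Real.log M) 1 1 1 (1 / 2) where
  δ_pos := one_pos
  δ_le_R := le_rfl
  C_nonneg := zero_le_one
  θ'_nonneg := by norm_num
  φ_zero _ _ := by simp [φJ]
  Ψ_zero_zero := smul_zero _
  hasDeriv_φ g _ _ _ := by
    have h3 : HasDerivAt (fun t : ℝ => t ^ 3) (3 * g ^ 2) g := by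
      simpa using hasDerivAt_pow 3 g
    have h := (hasDerivAt_id g).add (h3.const_mul (Real.log M))
    have e : (1 : ℝ) + Real.log M * (3 * g ^ 2) = 1 + 3 * Real.log M * g ^ 2 := by ring
    rw [e] at h
    exact h.hasDerivWithinAt
  hasFDeriv_φ _ _ _ _ := hasFDerivWithinAt_const _ _ _
  hasDeriv_Ψ _ _ y _ := hasDerivWithinAt_const _ _ _
  hasFDeriv_Ψ _ _ _ _ := ((1 / 2 : ℝ) • ContinuousLinearMap.id ℝ ℝ).hasFDerivWithinAt
  φg_bound g hg y _ := by
    have : (1 + 3 * Real.log M * g ^ 2) - (1 + 3 * (1 * Real.log M) * g ^ 2) = 0 := by ring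
    rw [this, abs_zero]
    have := hg.1
    positivity
  φy_bound g hg _ _ := by rw [norm_zero]; have := hg.1; positivity
  Ψg_bound g hg y _ := by rw [norm_zero]; have := hg.1; positivity
  Ψy_sub_A g hg y _ := by rw [sub_self, norm_zero]; have := hg.1; positivity
  Ψy_bound _ _ _ _ := norm_half_id_le'

/-- **Even `M` is dead weight for the regulator chart.** For every compact `G`, every `r` and every EVEN
`M ≥ 2`, `RegulatorChart G r M` is inhabited by the thin even-`M` chart with the curvature restriction of the
disprover's functional `expectE` as chart observables (no renormalisation-group content: only the Wilson arc is
ever pinned, and chart continuity is finite-torus regularity). [folklore] -/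
theorem nonempty_regulatorChart_of_even (hM : 2 ≤ M) (hMe : Even M) :
    Nonempty (RegulatorChart G r M) := by
  refine ⟨{
    two_le_M := hM
    E := ℝ
    φ := fun g _ => φJ M g
    Ψ := fun _ y => (1 / 2 : ℝ) • y
    A := (1 / 2 : ℝ) • ContinuousLinearMap.id ℝ ℝ
    φg := fun g _ => 1 + 3 * Real.log M * g ^ 2
    φy := fun _ _ => 0
    Ψg := fun _ _ => 0
    Ψy := fun _ _ => (1 / 2 : ℝ) • ContinuousLinearMap.id ℝ ℝ
    b₀ := 1
    θ := 1 / 2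
    C := 1
    δ := 1
    R := 1
    θ' := 1 / 2
    b₀_pos := one_pos
    θ_nonneg := by norm_num
    θ_lt_one := by norm_num
    norm_A_le := norm_half_id_le'
    θ'_lt_one := by norm_num
    smooth := smoothHalfChart_thin M
    yW := fun _ => 1
    g₀ := 1
    betaOf := fun g => 1 / g ^ 2
    κ := 1
    K := 0
    corr := fun p S n f => expectE r M hM n (fun _ => r.curvature) p S f
    realisation := {
      g₀_pos := one_pos
      g₀_le_δ := le_rfl
      continuousOn_yW := continuousOn_const
      norm_yW_le := fun _ _ => by simp
      strictAntiOn_betaOf := strictAntiOn_one_div_sq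
      continuousOn_betaOf := continuousOn_one_div_sq
      κ_pos := one_pos
      betaOf_sub_le := fun g _ => by simp
      corr_step := fun g y _ _ _ _ S n f => expectE_step r M hM n _ (g, y) S f
      corr_wilson := fun g hg L n f => by
        change expectE r M hM n (fun _ => r.curvature) (g, (1 : ℝ)) (2 * L + 1) f = _
        rw [expectE_wilson r M hM hMe n _ hg.1 1 L f, wilsonCentredSchwinger_cInd, if_pos fun _ => rfl]
      corr_continuousOn := fun S n f _ =>
        (continuous_expectE r M hM n (fun _ => r.curvature) S f).continuousOn } }⟩

/-- **Even `M` is dead weight for the regulator chart** (registered sub-goal `regulatorChart_even` of the crux item,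
all binders explicit): `∀ G r M, 2 ≤ M → Even M → Nonempty (RegulatorChart G r M)`. [folklore] -/
theorem regulatorChart_even :
    ∀ (G : Type) [Group G] [TopologicalSpace G] [IsTopologicalGroup G] [CompactSpace G]
      [MeasurableSpace G] [BorelSpace G]
      (r : Literature.MathematicalPhysics.QuantumFieldTheory.LatticeRep G) (M : ℕ), 2 ≤ M → Even M →
        Nonempty (Literature.MathematicalPhysics.QuantumFieldTheory.RegulatorChart G r M) :=
  fun _G _ _ _ _ _ _ r M hM hMe => nonempty_regulatorChart_of_even r M hM hMe

/-- **The line's load-bearing stub is equivalent to its restriction to odd block factors** (for the planner who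
promotes it): `(∀ G r, ∃ M₀, ∀ M ≥ M₀, Nonempty (RegulatorChart G r M)) ↔ (… ∀ M ≥ M₀, Odd M → …)`. [folklore] -/
theorem regulatorChartExists_iff_odd :
    (∀ (G : Type) [Group G] [TopologicalSpace G] [IsTopologicalGroup G] [CompactSpace G],
        IsCompactSimpleLieGroup G → letI : MeasurableSpace G := borel G; haveI : BorelSpace G := ⟨rfl⟩;
        ∀ (r : LatticeRep G), ∃ M₀ : ℕ, ∀ M : ℕ, M₀ ≤ M → Nonempty (RegulatorChart G r M)) ↔
      ∀ (G : Type) [Group G] [TopologicalSpace G] [IsTopologicalGroup G] [CompactSpace G],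
        IsCompactSimpleLieGroup G → letI : MeasurableSpace G := borel G; haveI : BorelSpace G := ⟨rfl⟩;
        ∀ (r : LatticeRep G), ∃ M₀ : ℕ, ∀ M : ℕ, M₀ ≤ M → Odd M → Nonempty (RegulatorChart G r M) := by
  constructor
  · intro h G _ _ _ _ hG r
    obtain ⟨M₀, hM₀⟩ := h G hG r
    exact ⟨M₀, fun M hM _ => hM₀ M hM⟩
  · intro h G _ _ _ _ hG r
    letI : MeasurableSpace G := borel G
    haveI : BorelSpace G := ⟨rfl⟩
    obtain ⟨M₀, hM₀⟩ := h G hG r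
    refine ⟨max M₀ 2, fun M hM => ?_⟩
    have h2 : 2 ≤ M := (le_max_right _ _).trans hM
    rcases Nat.even_or_odd M with he | ho
    · exact nonempty_regulatorChart_of_even r M h2 he
    · exact hM₀ M ((le_max_left _ _).trans hM) ho

end Summit.QuantumFields.YangMills.Theorems.BalabanStepParabolic

end
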